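import Literature.NumberTheory.GaloisRepresentations.OrdinaryPolarizedDeformationRingProofs
import Literature.NumberTheory.GaloisRepresentations.PolarizedDeformationRing
import HarnessLib

/-!
# Existence of the universal polarized `S`-unramified deformation ring in rank `n`:
# discharge of `polarizedDeformationRing_nonempty`

`Proofs` companion of `PolarizedDeformationRing`.  The named fact
`polarizedDeformationRing_nonempty` (a universal deformation ring for the lifts of a
`GL_n(k)`-valued residual representation `r̄` of `Γ_F` with scalar centralizer which are
unramified outside `S` and polarized in trace form — NO condition at the places above `p`) is
proved by the route of `OrdinaryPolarizedDeformationRingProofs` with the Borel clause deleted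
(deleting it only removes obligations):

* the generic rank-`n` rigidification machinery of that file is IMPORTED, not copied
  (`Deformation.commLinAt`, `conjSystemAt`, `existsUnique_conjSystemAt_eq_zero`,
  `exists_commLinAt_injective`, `oneAddEmbedGL`, `IsAdicContinuous.conj/comp_map`), and its two
  uses are ABSTRACTED here once and for all as statements about bare homomorphisms
  `Γ →* GL_n(A)` over a complete local ring: `Deformation.exists_conj_entry_eq` (every lift is
  strictly equivalent to one with prescribed entries at a rigidifying subsystem) and
  `Deformation.eq_of_isStrictEquiv_of_entry_eq` (two strictly equivalent lifts with the
  prescribed entries are equal) — the rank-`n` replacement of the Skinner–Wiles normalisation;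
* `PolarizedDatum.RigidData` (subsystem `(γ_q, r_q)` with lifts `s_q ∈ 𝒪`; exists under
  `HasScalarCentralizer`, `nonempty_rigidData`), `IsTypeLift` / `IsRigidLift`,
  `liftingCondition` (Mazur's axioms: the polarization and rigidity constraints are equations,
  unramifiedness is `ρ(I_𝔓) = 1`), `exists_rigid`, `rigid_unique`, `nonempty_deformationRing`
  (from the PROVED `LiftingCondition.exists_universal_of_finite`, [Maz, §20 Prop. 2]),
  `finite_carrier_dualCNL` (`Φ_p` for `G_{F,S}` from `finite_unramifiedHoms_holds`, Silverman
  VIII.1.6), and `polarizedDeformationRing_nonempty_holds`.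

Everything is proved; no named facts are introduced.

## References

* [Maz] B. Mazur, *An introduction to the deformation theory of Galois representations*, in
  Modular Forms and Fermat's Last Theorem (Springer 1997), §11 Prop., §20 Prop. 2, §21, §23,
  §26 Prop. 1. [cite: Mazur1997Deformation, §20 Prop. 2 and §26 Prop. 1]
* [CHT] L. Clozel, M. Harris, R. Taylor, *Automorphy for some `l`-adic lifts of automorphic mod
  `l` Galois representations*, Publ. Math. IHÉS 108 (2008), §2.2–2.3.
  [cite: ClozelHarrisTaylor2008, §2.2]
* J. Silverman, *The Arithmetic of Elliptic Curves*, 2nd ed., Prop. VIII.1.6.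
  [cite: SilvermanAEC2009, Prop. VIII.1.6]
-/

noncomputable section

open IsLocalRing Matrix IsDedekindDomain Field
open scoped NumberField

namespace Literature.NumberTheory.GaloisRepresentations

/-! ### Abstract rigidification over a complete local ring -/

namespace Deformation

section Rigidify

variable {Γ : Type*} [Group Γ] {n : ℕ} {A : Type*} [CommRing A] [IsLocalRing A]
  [IsAdicComplete (maximalIdeal A) A] {k : Type*} [Field k] {π : A →+* k} (hπ : Function.Surjective π)
  (γ : Pos (OffOrigin (n := n)) → Γ) (r : Pos (OffOrigin (n := n)) → Fin n × Fin n)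
  (s : Pos (OffOrigin (n := n)) → A)

include hπ in
/-- **Rigidification, existence (abstract form)**: over a complete local `A`, a homomorphism
`ρ : Γ → GL_n(A)` whose residual linearisation `Δ ↦ (([Δ, ρ̄(γ_q)])_{r_q})_q` at a square
off-origin subsystem is injective, and whose entries `ρ(γ_q)_{r_q}` reduce to the prescribed
values `s_q`, is strictly equivalent to a homomorphism with `ρ'(γ_q)_{r_q} = s_q` on the nose —
conjugate by the Newton–Hensel solution `1 + N`, `N ≡ 0` off-origin. [folklore] -/
theorem exists_conj_entry_eq (ρ : Γ →* GL (Fin n) A)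
    (hinj : Function.Injective (commLinAt (fun q => ((ρ (γ q)).val).map π) r))
    (hs : ∀ q, π ((ρ (γ q)).val (r q).1 (r q).2) = π (s q)) :
    ∃ P : GL (Fin n) A, Matrix.GeneralLinearGroup.map π P = 1 ∧
      ∀ q, (((MulAut.conj P).toMonoidHom.comp ρ) (γ q)).val (r q).1 (r q).2 = s q := by
  obtain ⟨c, ⟨hc, hzero⟩, -⟩ := existsUnique_conjSystemAt_eq_zero hπ (fun q => (ρ (γ q)).val) r s hinj hs
  refine ⟨oneAddEmbedGL c hc, map_oneAddEmbedGL hπ c hc, fun q => ?_⟩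
  have hq := congrFun hzero q
  rw [Pi.zero_apply, conjSystemAt, sub_eq_zero] at hq
  simp only [MonoidHom.comp_apply, MulEquiv.coe_toMonoidHom, MulAut.conj_apply, Units.val_mul,
    oneAddEmbedGL_val, oneAddEmbedGL_inv_val]
  exact hq

include hπ in
/-- **Rigidification, uniqueness (abstract form)**: two strictly equivalent homomorphisms
`ρ₁, ρ₂ : Γ → GL_n(A)` over a complete local `A` with the same prescribed entries
`ρ_i(γ_q)_{r_q} = s_q` at a square off-origin subsystem whose residual linearisation (for `ρ₁`)
is injective are EQUAL.  If `ρ₂ = P ρ₁ P⁻¹` with `P ≡ 1`, normalise `P = λ (1 + N)` with `N`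
off-origin and `≡ 0`; then `N` solves the rigidifying system of `ρ₁`, as does `0`, so `N = 0` by
the uniqueness half of Newton–Hensel and `P` is scalar. [folklore] -/
theorem eq_of_isStrictEquiv_of_entry_eq {ρ₁ ρ₂ : Γ →* GL (Fin n) A}
    (hinj : Function.Injective (commLinAt (fun q => ((ρ₁ (γ q)).val).map π) r))
    (h₁ : ∀ q, (ρ₁ (γ q)).val (r q).1 (r q).2 = s q) (h₂ : ∀ q, (ρ₂ (γ q)).val (r q).1 (r q).2 = s q)
    (e : IsStrictEquiv π ρ₁ ρ₂) : ρ₁ = ρ₂ := by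
  obtain ⟨P, hP, hconj⟩ := e
  rcases Nat.eq_zero_or_pos n with hn | hn
  · subst hn
    exact MonoidHom.ext fun γ => Units.ext (Subsingleton.elim _ _)
  let o : Fin n := ⟨0, hn⟩
  -- the residue of `P` is `1`
  have hPres : ∀ i j, π (P.val i j) = (1 : Matrix (Fin n) (Fin n) k) i j := by
    intro i j
    rw [← Matrix.GeneralLinearGroup.map_apply, hP, Units.val_one]
  have hunit : IsUnit (P.val o o) := by
    rw [isUnit_iff_residue_ne_zero hπ, hPres, Matrix.one_apply_eq]; exact one_ne_zero
  set u : Aˣ := hunit.unit with hu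
  have huval : (u : A) = P.val o o := rfl
  have hπu : π ((u⁻¹ : Aˣ) : A) = 1 := by
    have h1 : π (u : A) = 1 := by rw [huval, hPres, Matrix.one_apply_eq]
    have h2 : π ((u⁻¹ : Aˣ) : A) * π (u : A) = 1 := by
      rw [← map_mul, Units.inv_mul, map_one]
    rwa [h1, mul_one] at h2
  -- `N = u⁻¹ P - 1` is off-origin and `≡ 0`
  set N : Matrix (Fin n) (Fin n) A := ((u⁻¹ : Aˣ) : A) • P.val - 1 with hN
  have hNoo : N o o = 0 := by
    rw [hN, Matrix.sub_apply, Matrix.smul_apply, Matrix.one_apply_eq, smul_eq_mul, ← huval, Units.inv_mul,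
      sub_self]
  have hNmem : ∀ i j, N i j ∈ maximalIdeal A := by
    intro i j
    rw [mem_maximalIdeal_iff_residue_eq_zero hπ, hN, Matrix.sub_apply, Matrix.smul_apply, smul_eq_mul,
      map_sub, map_mul, hπu, one_mul, hPres]
    by_cases hij : i = j
    · subst hij; rw [Matrix.one_apply_eq, Matrix.one_apply_eq, map_one, sub_self]
    · rw [Matrix.one_apply_ne hij, Matrix.one_apply_ne hij, map_zero, sub_self]
  let c : Pos (OffOrigin (n := n)) → A := fun q => N q.1.1 q.1.2
  have hc : ∀ q, c q ∈ maximalIdeal A := fun q => hNmem _ _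
  have hcN : embed c = N := by
    ext i j
    by_cases hq : OffOrigin (i, j)
    · rw [embed_apply_of_pos c hq]
    · rw [embed_apply_of_not c hq]
      have hi : i = o := Fin.ext (not_not.1 (fun h => hq fun h' => h h'.1))
      have hj : j = o := Fin.ext (by
        by_contra h; exact hq fun h' => h h'.2)
      rw [hi, hj, hNoo]
  -- conjugation by `1 + N` is conjugation by `P`
  have h1N : 1 + embed c = ((u⁻¹ : Aˣ) : A) • P.val := by rw [hcN, hN]; abel
  have hinvP : (1 + embed c)⁻¹ = (u : A) • (P⁻¹).val := by
    apply Matrix.inv_eq_right_inv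
    rw [h1N, Matrix.smul_mul, Matrix.mul_smul, smul_smul, ← Units.val_mul P P⁻¹, mul_inv_cancel,
      Units.val_one, Units.inv_mul, one_smul]
  have hconjN : ∀ X : Matrix (Fin n) (Fin n) A, (1 + embed c) * X * (1 + embed c)⁻¹ = P.val * X * (P⁻¹).val := by
    intro X
    rw [hinvP, h1N, Matrix.smul_mul, Matrix.smul_mul, Matrix.mul_smul, smul_smul, Units.inv_mul, one_smul]
  -- both `c` and `0` solve the rigidifying system of `ρ₁`
  set M : Pos (OffOrigin (n := n)) → Matrix (Fin n) (Fin n) A := fun q => (ρ₁ (γ q)).val with hM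
  have hsres : ∀ q, π (M q (r q).1 (r q).2) = π (s q) := by
    intro q; rw [hM]; exact congrArg _ (h₁ q)
  obtain ⟨c₀, -, huniq⟩ := existsUnique_conjSystemAt_eq_zero hπ M r s hinj hsres
  have hzero_c : conjSystemAt M r s c = 0 := by
    funext q
    rw [Pi.zero_apply, conjSystemAt, sub_eq_zero, hM, hconjN, ← Units.val_mul, ← Units.val_mul, ← hconj]
    exact h₂ q
  have hzero_0 : conjSystemAt M r s 0 = 0 := by
    funext q
    rw [Pi.zero_apply, conjSystemAt_zero, sub_eq_zero, hM]
    exact h₁ q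
  have hc0 : c = 0 :=
    (huniq c ⟨hc, hzero_c⟩).trans (huniq 0 ⟨fun _ => Ideal.zero_mem _, hzero_0⟩).symm
  -- hence `P` is scalar and `ρ₂ = ρ₁`
  have hPscalar : P.val = (u : A) • (1 : Matrix (Fin n) (Fin n) A) := by
    have h0 : N = 0 := by rw [← hcN, hc0]; exact embed_zero
    rw [hN, sub_eq_zero] at h0
    rw [← h0, smul_smul, Units.mul_inv, one_smul]
  refine (MonoidHom.ext fun γ => ?_).symm
  have hcomm : P * ρ₁ γ = ρ₁ γ * P := Units.ext (by
    rw [Units.val_mul, Units.val_mul, hPscalar, Matrix.smul_mul, Matrix.mul_smul, Matrix.one_mul, Matrix.mul_one])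
  rw [hconj γ, hcomm, mul_inv_cancel_right]

end Rigidify

end Deformation

/-! ### Rigidification data for a polarized residual datum -/

namespace PolarizedDatum

open Deformation

variable {F₀ F : Type} [Field F₀] [Field F] [NumberField F] [Algebra F₀ F] [IsGalois F₀ F]
  {p n : ℕ} [Fact p.Prime] {𝒪 : Type} [CommRing 𝒪] [Algebra ℤ_[p] 𝒪] {k : Type} [Field k] [Algebra 𝒪 k]
  (𝒟 : PolarizedDatum F₀ F p n 𝒪 k)

/-- **Rigidification data** for the polarized residual datum `𝒟` in rank `n`: a square
rigidifying subsystem — elements `γ_q ∈ Γ_F` and read positions `r_q`, indexed by the off-origin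
positions `q`, at which the residual linearisation `Δ ↦ (([Δ, r̄(γ_q)])_{r_q})_q` is injective
(available when `r̄` has scalar centralizer), with lifts `s_q ∈ 𝒪` of the residual entries
`r̄(γ_q)_{r_q}`.  (The ordinary file's `RigidData` minus the frame lifts and separating families
at `v ∣ p`.) [folklore] -/
structure RigidData where
  /-- The elements of the rigidifying subsystem. -/
  γ : Pos (OffOrigin (n := n)) → absoluteGaloisGroup F
  /-- The read positions of the rigidifying subsystem. -/
  r : Pos (OffOrigin (n := n)) → Fin n × Fin n
  /-- The residual linearisation of the subsystem is injective. -/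
  inj : Function.Injective (commLinAt (fun q => (𝒟.residual (γ q)).val) r)
  /-- The prescribed values (lifts to `𝒪` of the residual entries). -/
  s : Pos (OffOrigin (n := n)) → 𝒪
  /-- The prescribed values lift the residual entries. -/
  s_spec : ∀ q, algebraMap 𝒪 k (s q) = (𝒟.residual (γ q)).val (r q).1 (r q).2

/-- **Rigidification data exist** when `r̄` has scalar centralizer ([Maz, §11]); `𝒪 → k` onto
lifts the entries.  No hypothesis at `v ∣ p`. [folklore] -/
theorem nonempty_rigidData (hsc : 𝒟.HasScalarCentralizer) : Nonempty 𝒟.RigidData := by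
  classical
  obtain ⟨γ, r, hinj⟩ := exists_commLinAt_injective (fun γ => (𝒟.residual γ).val) hsc
  choose s hs using fun q : Pos (OffOrigin (n := n)) =>
    𝒟.residueMap_surjective ((𝒟.residual (γ q)).val (r q).1 (r q).2)
  exact ⟨⟨γ, r, hinj, s, hs⟩⟩

/-- **Lifts of type `𝒟`** over a local `𝒪`-algebra `A` with a bare augmentation `π : A →+* k`
(the form consumed by `Deformation.LiftingCondition`): continuous lifts of `r̄`, unramified
outside `S`, polarized. [cite: ClozelHarrisTaylor2008, Def. 2.2.1] -/
structure IsTypeLift {A : Type} [CommRing A] [Algebra 𝒪 A] [IsLocalRing A] (π : A →+* k)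
    (ρ : absoluteGaloisGroup F →* GL (Fin n) A) : Prop where
  /-- `ρ` is `𝔪_A`-adically continuous. -/
  isAdicContinuous : IsAdicContinuous ρ
  /-- `ρ` reduces to `r̄`. -/
  residual_eq : (Matrix.GeneralLinearGroup.map π).comp ρ = 𝒟.residual
  /-- `ρ` is unramified outside `S`. -/
  unramified : ∀ v ∉ 𝒟.S, IsUnramifiedAt v ρ
  /-- `ρ` is polarized in trace form. -/
  polarized : ∀ c ∈ 𝒟.Θ, ∀ σ, (ρ (absGaloisOuterConj F₀ F c σ)).val.trace =
    algebraMap 𝒪 A (algebraMap ℤ_[p] 𝒪 (((GaloisRep.cyclotomicCharacter F p σ) ^ 𝒟.m : ℤ_[p]ˣ) : ℤ_[p])) *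
      (ρ σ⁻¹).val.trace

/-- `𝒟.IsDeformation π ρ` is `𝒟.IsTypeLift (π : A →+* k) ρ` (the interface packages the four
clauses as a conjunction). [folklore] -/
theorem isDeformation_iff_isTypeLift {A : Type} [CommRing A] [Algebra 𝒪 A] [IsLocalRing A]
    (π : A →ₐ[𝒪] k) (ρ : absoluteGaloisGroup F →* GL (Fin n) A) :
    𝒟.IsDeformation π ρ ↔ 𝒟.IsTypeLift (π : A →+* k) ρ :=
  ⟨fun h => ⟨h.1, h.2.1, h.2.2.1, h.2.2.2⟩, fun h => ⟨h.1, h.2, h.3, h.4⟩⟩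

/-- **The type condition is invariant under strict equivalence** (through
`isDeformation_iff_isTypeLift` and `IsDeformation.of_isStrictEquiv`).
[cite: ClozelHarrisTaylor2008, Def. 2.2.2] -/
theorem IsTypeLift.of_isStrictEquiv {𝒟 : PolarizedDatum F₀ F p n 𝒪 k} {A : Type} [CommRing A] [Algebra 𝒪 A] [IsLocalRing A] (π : A →ₐ[𝒪] k)
    {ρ ρ' : absoluteGaloisGroup F →* GL (Fin n) A}
    (h : 𝒟.IsTypeLift (π : A →+* k) ρ) (e : IsStrictEquiv (π : A →+* k) ρ ρ') :
    𝒟.IsTypeLift (π : A →+* k) ρ' :=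
  (𝒟.isDeformation_iff_isTypeLift π ρ').1 (((𝒟.isDeformation_iff_isTypeLift π ρ).2 h).of_isStrictEquiv e)

namespace RigidData

variable {𝒟} (R : 𝒟.RigidData)

/-- **Rigid lifts of type `𝒟`**: type-`𝒟` lifts whose entries at the rigidifying subsystem take
the prescribed values, `ρ(γ_q)_{r_q} = s_q`. [folklore] -/
structure IsRigidLift {A : Type} [CommRing A] [Algebra 𝒪 A] [IsLocalRing A] (π : A →+* k)
    (ρ : absoluteGaloisGroup F →* GL (Fin n) A) : Prop extends 𝒟.IsTypeLift π ρ where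
  /-- The prescribed entries. -/
  entry_eq : ∀ q, (ρ (R.γ q)).val (R.r q).1 (R.r q).2 = algebraMap 𝒪 A (R.s q)

/-- **Functoriality of rigid lifts** along morphisms of `Ĉ_𝒪(k)`. [folklore] -/
theorem IsRigidLift.map (hk : Function.Surjective (algebraMap 𝒪 k)) {A B : CNLAlgebra 𝒪 k}
    (φ : A →ₐ[𝒪] B) {ρ : absoluteGaloisGroup F →* GL (Fin n) A} (h : R.IsRigidLift (A.residue : A →+* k) ρ) :
    R.IsRigidLift (B.residue : B →+* k) ((Matrix.GeneralLinearGroup.map (φ : A →+* B)).comp ρ) := by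
  have hπ : (B.residue : B →+* k).comp (φ : A →+* B) = A.residue := by
    ext a; exact CNLAlgebra.residue_map hk φ a
  refine ⟨⟨h.isAdicContinuous.comp_map hk φ, ?_, fun v hv 𝔓 h𝔓 σ hσ => ?_, fun c hc σ => ?_⟩, fun q => ?_⟩
  · rw [← MonoidHom.comp_assoc, ← Matrix.GeneralLinearGroup.map_comp, hπ, h.residual_eq]
  · rw [MonoidHom.comp_apply, h.unramified v hv 𝔓 h𝔓 σ hσ, map_one]
  · have := congrArg φ (h.polarized c hc σ)
    rw [map_mul, AlgHom.commutes, AddMonoidHom.map_trace, AddMonoidHom.map_trace] at this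
    rw [val_map_comp_apply, val_map_comp_apply]
    exact this
  · change φ ((ρ (R.γ q)).val (R.r q).1 (R.r q).2) = algebraMap 𝒪 B (R.s q)
    rw [h.entry_eq, AlgHom.commutes]

/-- **`r̄` itself is a rigid lift over `k`.** [folklore] -/
theorem isRigidLift_residual : R.IsRigidLift (RingHom.id k) 𝒟.residual := by
  have hres : (Matrix.GeneralLinearGroup.map (RingHom.id k)).comp 𝒟.residual = 𝒟.residual := by
    rw [Matrix.GeneralLinearGroup.map_id]; rfl
  exact ⟨⟨Deformation.isAdicContinuous_of_isOpen_ker 𝒟.isOpen_ker_residual, hres, 𝒟.residual_unramified,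
    𝒟.residual_polarized⟩, fun q => (R.s_spec q).symm⟩

variable (hk : Function.Surjective (algebraMap 𝒪 k))

/-- **The rigid polarized lifting condition `𝒞_𝒟`** attached to `𝒟` and rigidification data
`R`: its admissible lifts over `A ∈ Ĉ_𝒪(k)` are the rigid lifts of type `𝒟`.  It satisfies
Mazur's axioms of a deformation condition: functoriality, `r̄ ∈ 𝒞(k)`, and the gluing axiom for
jointly injective families (unramifiedness, the polarization and the rigidity constraints are
equations in `A`) — "given a Global Galois deformation problem, the full subcategory … defines
a deformation condition for `G_{K,S}`". [cite: Mazur1997Deformation, §23 and §26 Prop. 1] -/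
def liftingCondition : LiftingCondition 𝒪 k (absoluteGaloisGroup F) n 𝒟.residual where
  carrier A := {ρ | R.IsRigidLift (A.residue : A →+* k) ρ}
  map_mem φ _ h := h.map R hk φ
  self_mem := R.isRigidLift_residual
  residual_eq h := h.residual_eq
  isAdicContinuous h := h.isAdicContinuous
  mem_of_jointly_injective := by
    intro A ι B φ hinj ρ hcont hmem
    have hne : Nonempty ι := by
      by_contra hι
      rw [not_nonempty_iff] at hι
      exact one_ne_zero (hinj 1 fun i => (IsEmpty.false i).elim)
    obtain ⟨i₁⟩ := hne
    have hπ : ∀ i, ((B i).residue : B i →+* k).comp (φ i : A →+* B i) = A.residue := fun i => by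
      ext a; exact CNLAlgebra.residue_map hk (φ i) a
    have hres : (Matrix.GeneralLinearGroup.map (A.residue : A →+* k)).comp ρ = 𝒟.residual := by
      rw [← hπ i₁, Matrix.GeneralLinearGroup.map_comp, MonoidHom.comp_assoc]
      exact (hmem i₁).residual_eq
    have hentry : ∀ (γ : absoluteGaloisGroup F) (a b : Fin n) (c : A),
        (∀ i, ((Matrix.GeneralLinearGroup.map (φ i : A →+* B i)).comp ρ γ).val a b = φ i c) →
        (ρ γ).val a b = c := by
      intro γ a b c h
      rw [← sub_eq_zero]
      refine hinj _ fun i => ?_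
      rw [map_sub, sub_eq_zero, ← h i, MonoidHom.comp_apply, Matrix.GeneralLinearGroup.map_apply]
      rfl
    refine ⟨⟨hcont, hres, fun v hv 𝔓 h𝔓 σ hσ => ?_, fun c hc σ => ?_⟩, fun q => ?_⟩
    · apply Units.ext; ext a b
      refine hentry σ a b ((1 : GL (Fin n) A).val a b) fun i => ?_
      rw [(hmem i).unramified v hv 𝔓 h𝔓 σ hσ]
      change (1 : Matrix (Fin n) (Fin n) (B i)) a b = φ i ((1 : Matrix (Fin n) (Fin n) A) a b)
      by_cases hab : a = b
      · subst hab; rw [Matrix.one_apply_eq, Matrix.one_apply_eq, map_one]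
      · rw [Matrix.one_apply_ne hab, Matrix.one_apply_ne hab, map_zero]
    · rw [← sub_eq_zero]
      refine hinj _ fun i => ?_
      rw [map_sub, map_mul, sub_eq_zero, AlgHom.commutes, AddMonoidHom.map_trace, AddMonoidHom.map_trace]
      have := (hmem i).polarized c hc σ
      rw [val_map_comp_apply, val_map_comp_apply] at this
      exact this
    · exact hentry _ _ _ _ fun i => by rw [(hmem i).entry_eq, AlgHom.commutes]

/-! #### Rigidification: existence and uniqueness of the rigid representative -/

section Rigidify

/-- Entries of a lift reduce to the entries of `r̄`. [folklore] -/
theorem residual_val_map {A : Type} [CommRing A] {π : A →+* k} {ρ : absoluteGaloisGroup F →* GL (Fin n) A}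
    (hres : (Matrix.GeneralLinearGroup.map π).comp ρ = 𝒟.residual) (γ : absoluteGaloisGroup F) :
    ((ρ γ).val).map π = (𝒟.residual γ).val := by
  have h1 := DFunLike.congr_fun hres γ
  rw [MonoidHom.comp_apply] at h1
  rw [← h1]; rfl

/-- The residual linearisation of the rigidifying subsystem of a lift is that of `r̄`, hence
injective. [folklore] -/
theorem commLinAt_injective_of_residual_eq {A : Type} [CommRing A] {π : A →+* k}
    {ρ : absoluteGaloisGroup F →* GL (Fin n) A}
    (hres : (Matrix.GeneralLinearGroup.map π).comp ρ = 𝒟.residual) :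
    Function.Injective (commLinAt (fun q => ((ρ (R.γ q)).val).map π) R.r) := by
  have : (fun q => ((ρ (R.γ q)).val).map π) = fun q => (𝒟.residual (R.γ q)).val := by
    funext q; exact residual_val_map hres (R.γ q)
  rw [this]; exact R.inj

variable {A : Type} [CommRing A] [Algebra 𝒪 A] [IsLocalRing A] [IsAdicComplete (maximalIdeal A) A]
  (π : A →ₐ[𝒪] k) (hπ : Function.Surjective π)

include hπ in
/-- **Rigidification, existence**: over a complete local `A`, every lift of type `𝒟` is strictly
equivalent to a rigid one (`Deformation.exists_conj_entry_eq`). [folklore] -/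
theorem exists_rigid {ρ : absoluteGaloisGroup F →* GL (Fin n) A} (h : 𝒟.IsTypeLift (π : A →+* k) ρ) :
    ∃ ρr, R.IsRigidLift (π : A →+* k) ρr ∧ IsStrictEquiv (π : A →+* k) ρ ρr := by
  have hπo : ∀ o, (π : A →+* k) (algebraMap 𝒪 A o) = algebraMap 𝒪 k o := fun o => π.commutes o
  have hsres : ∀ q, (π : A →+* k) ((ρ (R.γ q)).val (R.r q).1 (R.r q).2) =
      (π : A →+* k) (algebraMap 𝒪 A (R.s q)) := by
    intro q
    rw [hπo, R.s_spec q, ← Matrix.map_apply (f := (π : A →+* k)), residual_val_map h.residual_eq]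
  obtain ⟨P, hP1, hP⟩ := exists_conj_entry_eq hπ R.γ R.r (fun q => algebraMap 𝒪 A (R.s q)) ρ
    (R.commLinAt_injective_of_residual_eq h.residual_eq) hsres
  exact ⟨(MulAut.conj P).toMonoidHom.comp ρ,
    ⟨h.of_isStrictEquiv π (isStrictEquiv_conj_of_map_eq_one P hP1 ρ), hP⟩,
    isStrictEquiv_conj_of_map_eq_one P hP1 ρ⟩

include hπ in
/-- **Rigidification, uniqueness**: two strictly equivalent rigid lifts over a complete local `A`
are equal (`Deformation.eq_of_isStrictEquiv_of_entry_eq`). [folklore] -/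
theorem rigid_unique {ρ₁ ρ₂ : absoluteGaloisGroup F →* GL (Fin n) A} (h₁ : R.IsRigidLift (π : A →+* k) ρ₁)
    (h₂ : R.IsRigidLift (π : A →+* k) ρ₂) (e : IsStrictEquiv (π : A →+* k) ρ₁ ρ₂) : ρ₁ = ρ₂ :=
  eq_of_isStrictEquiv_of_entry_eq hπ R.γ R.r (fun q => algebraMap 𝒪 A (R.s q))
    (R.commLinAt_injective_of_residual_eq h₁.residual_eq) h₁.entry_eq h₂.entry_eq e

end Rigidify

/-! ### From the rigid universal ring to the polarized deformation ring -/

section DeformationRing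

variable [IsNoetherianRing 𝒪] [Finite k]

/-- **The polarized deformation ring from the rigid universal ring.**  If the rigid lifting
condition `𝒞_𝒟` has finitely many `k[ε]`-points, then `r̄` admits a universal deformation ring
of type `𝒟`: it is Mazur's universal ring of `𝒞_𝒟` (`LiftingCondition.exists_universal_of_finite`,
§20 Prop. 2), and the universal property among *deformations* follows from rigidification
(`exists_rigid`, `rigid_unique`). [cite: Mazur1997Deformation, §20 Prop. 2]
[cite: ClozelHarrisTaylor2008, §2.2] -/
theorem nonempty_deformationRing
    (hfin : ((R.liftingCondition hk).carrier (dualCNL 𝒪 k)).Finite) :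
    Nonempty (PolarizedDeformationRing 𝒟) := by
  classical
  obtain ⟨U, hUn, hUo, hUanti, hUle, hUcof⟩ :=
    absoluteGaloisGroup_exists_antitone_openNormal_seq F 𝒟.residual.ker 𝒟.isOpen_ker_residual
  haveI : ∀ N, (U N).Normal := hUn
  haveI : ∀ N, Finite (absoluteGaloisGroup F ⧸ U N) := fun N => Subgroup.quotient_finite_of_isOpen _ (hUo N)
  have hUo' : ∀ N ⦃H : Subgroup (absoluteGaloisGroup F)⦄, U N ≤ H → IsOpen (H : Set (absoluteGaloisGroup F)) :=
    fun N H hH => Subgroup.isOpen_mono hH (hUo N)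
  obtain ⟨Rᵤ, ρu, hρu, huniv⟩ := (R.liftingCondition hk).exists_universal_of_finite hk U hUle hUo' hUanti
    (fun V _ hV => hUcof V hV) hfin
  have hρu' : R.IsRigidLift (Rᵤ.residue : Rᵤ →+* k) ρu := hρu
  refine ⟨{ R := Rᵤ, π := Rᵤ.residue, π_surjective := Rᵤ.residue_surjective, ρ := ρu,
            isDeformation := (𝒟.isDeformation_iff_isTypeLift Rᵤ.residue ρu).2 hρu'.toIsTypeLift,
            universal := ?_ }⟩
  intro A _ _ _ _ _ πA hπA ρA hdef
  have htl : 𝒟.IsTypeLift (πA : A →+* k) ρA := (𝒟.isDeformation_iff_isTypeLift πA ρA).1 hdef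
  obtain ⟨ρr, hρr, e⟩ := R.exists_rigid πA hπA htl
  have hmem : ρr ∈ (R.liftingCondition hk).carrier (CNLAlgebra.mk A πA hπA) := hρr
  obtain ⟨φ, hφ, hφu⟩ := huniv (CNLAlgebra.mk A πA hπA) ρr hmem
  refine ⟨φ, ?_, fun ψ hψ => ?_⟩
  · change IsStrictEquiv (πA : A →+* k) ((Matrix.GeneralLinearGroup.map (φ : Rᵤ →+* A)).comp ρu) ρA
    have hφ' : (Matrix.GeneralLinearGroup.map (φ : Rᵤ →+* A)).comp ρu = ρr := hφ
    rw [hφ']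
    exact e.symm
  · apply hφu
    change IsStrictEquiv (πA : A →+* k) ((Matrix.GeneralLinearGroup.map (ψ : Rᵤ →+* A)).comp ρu) ρA at hψ
    change (Matrix.GeneralLinearGroup.map (ψ : Rᵤ →+* A)).comp ρu = ρr
    have h1 : (Matrix.GeneralLinearGroup.map (ψ : Rᵤ →+* A)).comp ρu ∈
        (R.liftingCondition hk).carrier (CNLAlgebra.mk A πA hπA) :=
      (R.liftingCondition hk).map_mem (A := Rᵤ) (B := CNLAlgebra.mk A πA hπA) ψ hρu
    have h2 : R.IsRigidLift (πA : A →+* k) ((Matrix.GeneralLinearGroup.map (ψ : Rᵤ →+* A)).comp ρu) := h1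
    exact R.rigid_unique πA hπA h2 hρr (hψ.trans e)

end DeformationRing

/-! ### Finiteness of the rigid lifts to `k[ε]` -/

section Finiteness

variable [Finite k]

open Literature.NumberTheory.EllipticCurves

/-- On `ker r̄`, an admissible lift to `k[ε]` has `fst`-part `1`. [folklore] -/
theorem map_fst_eq_one {ρ : absoluteGaloisGroup F →* GL (Fin n) (dualCNL 𝒪 k)}
    (hρ : ρ ∈ (R.liftingCondition hk).carrier (dualCNL 𝒪 k)) {σ : absoluteGaloisGroup F}
    (hσ : σ ∈ 𝒟.residual.ker) : (ρ σ).val.map TrivSqZeroExt.fst = 1 := by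
  ext i j
  have h := (R.liftingCondition hk).residue_apply_val hρ σ i j
  rw [MonoidHom.mem_ker] at hσ
  rw [hσ] at h
  exact h

/-- **The tangent map of a rigid lift to `k[ε]` lies in `Hom(ker r̄, M_n(k); S)`**: it is
continuous (the lift has open kernel), additive on `ker r̄` (Leibniz rule with `fst = 1`), and
vanishes on the inertia groups above `v ∉ S` (the tangent map is the ordinary file's
`OrdinaryPolarizedDatum.RigidData.tangentMap`). [cite: Mazur1997Deformation, §21] -/
theorem tangentMap_mem_unramifiedHoms [TopologicalSpace (Matrix (Fin n) (Fin n) k)]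
    [DiscreteTopology (Matrix (Fin n) (Fin n) k)]
    {ρ : absoluteGaloisGroup F →* GL (Fin n) (dualCNL 𝒪 k)}
    (hρ : ρ ∈ (R.liftingCondition hk).carrier (dualCNL 𝒪 k)) :
    OrdinaryPolarizedDatum.RigidData.tangentMap ρ 𝒟.residual.ker ∈
      unramifiedHoms 𝒟.residual.ker (Matrix (Fin n) (Fin n) k) 𝒟.S := by
  have hρ' : R.IsRigidLift ((dualCNL 𝒪 k).residue : dualCNL 𝒪 k →+* k) ρ := hρ
  refine ⟨?_, fun σ τ => ?_, fun v hv 𝔓 h𝔓 σ hσ => ?_⟩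
  · have hker := isOpen_ker_of_isAdicContinuous_dualCNL hρ'.isAdicContinuous
    have hc : Continuous fun γ : absoluteGaloisGroup F => (ρ γ).val.map TrivSqZeroExt.snd :=
      continuous_def.2 fun T _ => isOpen_preimage_of_isOpen_ker ρ hker
        ((fun P : GL (Fin n) (dualCNL 𝒪 k) => P.val.map TrivSqZeroExt.snd) ⁻¹' T)
    exact hc.comp continuous_subtype_val
  · change (ρ (σ.1 * τ.1)).val.map TrivSqZeroExt.snd =
      (ρ σ.1).val.map TrivSqZeroExt.snd + (ρ τ.1).val.map TrivSqZeroExt.snd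
    rw [map_mul, Units.val_mul, dualCNL_map_snd_mul, R.map_fst_eq_one hk hρ σ.2, R.map_fst_eq_one hk hρ τ.2,
      Matrix.one_mul, Matrix.mul_one, add_comm]
  · change (ρ σ.1).val.map TrivSqZeroExt.snd = 0
    rw [hρ'.unramified v hv 𝔓 h𝔓 σ.1 hσ, Units.val_one, dualCNL_map_snd_one]

/-- **Finiteness of the `k[ε]`-points of the rigid lifting condition** (Mazur's hypothesis `Φ_p`
for `Π = G_{F,S}` in the form needed by §20 Prop. 2): a rigid lift `ρ` of `r̄` to `k[ε]` is
determined by its values on coset representatives of the open subgroup `ker r̄` and by its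
tangent map on `ker r̄`, which lies in the finite set `Hom(ker r̄, M_n(k); S)`
(`finite_unramifiedHoms_holds`, Hermite–Minkowski).
[cite: Mazur1997Deformation, §21] [cite: SilvermanAEC2009, Prop. VIII.1.6] -/
theorem finite_carrier_dualCNL : ((R.liftingCondition hk).carrier (dualCNL 𝒪 k)).Finite := by
  classical
  letI : TopologicalSpace (Matrix (Fin n) (Fin n) k) := ⊥
  haveI : DiscreteTopology (Matrix (Fin n) (Fin n) k) := ⟨rfl⟩
  set U := 𝒟.residual.ker with hU
  have hUo : IsOpen (U : Set (absoluteGaloisGroup F)) := 𝒟.isOpen_ker_residual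
  haveI : Finite (absoluteGaloisGroup F ⧸ U) := Subgroup.quotient_finite_of_isOpen U hUo
  haveI : Finite (GL (Fin n) (dualCNL 𝒪 k)) := Finite.of_injective _ Units.val_injective
  have hfinHom : (unramifiedHoms U (Matrix (Fin n) (Fin n) k) 𝒟.S).Finite :=
    finite_unramifiedHoms_holds F U hUo (Matrix (Fin n) (Fin n) k) 𝒟.S_finite
  let Φ : (absoluteGaloisGroup F →* GL (Fin n) (dualCNL 𝒪 k)) →
      (U → Matrix (Fin n) (Fin n) k) × (absoluteGaloisGroup F ⧸ U → GL (Fin n) (dualCNL 𝒪 k)) :=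
    fun ρ => (OrdinaryPolarizedDatum.RigidData.tangentMap ρ U, fun q => ρ q.out)
  refine Set.Finite.of_finite_image (f := Φ) ((hfinHom.prod (Set.finite_univ)).subset ?_) ?_
  · rintro _ ⟨ρ, hρ, rfl⟩
    exact ⟨R.tangentMap_mem_unramifiedHoms hk hρ, Set.mem_univ _⟩
  · intro ρ₁ h₁ ρ₂ h₂ h
    have hf : OrdinaryPolarizedDatum.RigidData.tangentMap ρ₁ U = OrdinaryPolarizedDatum.RigidData.tangentMap ρ₂ U :=
      congrArg Prod.fst h
    have hq : ∀ q : absoluteGaloisGroup F ⧸ U, ρ₁ q.out = ρ₂ q.out := fun q => congrFun (congrArg Prod.snd h) q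
    have hUeq : ∀ u : absoluteGaloisGroup F, u ∈ U → ρ₁ u = ρ₂ u := by
      intro u hu
      apply Units.ext
      refine dualCNL_matrix_ext ?_ ?_
      · rw [R.map_fst_eq_one hk h₁ hu, R.map_fst_eq_one hk h₂ hu]
      · exact congrFun hf ⟨u, hu⟩
    ext γ : 1
    obtain ⟨u, hu⟩ := QuotientGroup.mk_out_eq_mul U γ
    have hγ : γ = (QuotientGroup.mk γ : absoluteGaloisGroup F ⧸ U).out * (u : absoluteGaloisGroup F)⁻¹ := by
      rw [hu, mul_inv_cancel_right]
    rw [hγ, map_mul, map_mul, map_inv, map_inv, hq, hUeq u u.2]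

end Finiteness

end RigidData

end PolarizedDatum

/-! ### The ordinary polarized ring is an algebra over the polarized one -/

/-- **`R^{ord,pol}_𝒟` receives a canonical map from `R^{pol}_{𝒟.toPolarized}`**: the universal
ordinary polarized deformation is in particular a polarized `S`-unramified deformation
(`OrdinaryPolarizedDatum.IsDeformation.toPolarized`), so the universal property of the polarized
ring gives a unique `𝒪`-algebra map `R^{pol} → R^{ord,pol}` carrying `ρ^{univ,pol}` to
`ρ^{univ,ord,pol}` up to strict equivalence ("`𝒟_ρ̄` is pro-representable by a quotient ring of
the ring pro-representing `D_ρ̄`" — here only the map; surjectivity is not claimed).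
[cite: Mazur1997Deformation, §23] -/
theorem OrdinaryPolarizedDeformationRing.existsUnique_algHom_of_polarized
    {F₀ F : Type} [Field F₀] [Field F] [NumberField F] [Algebra F₀ F] [IsGalois F₀ F]
    {p n : ℕ} [Fact p.Prime] {𝒪 : Type} [CommRing 𝒪] [Algebra ℤ_[p] 𝒪] {k : Type} [Field k] [Algebra 𝒪 k]
    {𝒟 : OrdinaryPolarizedDatum F₀ F p n 𝒪 k} (𝓡' : OrdinaryPolarizedDeformationRing 𝒟)
    (𝓡 : PolarizedDeformationRing 𝒟.toPolarized) :
    ∃! φ : 𝓡.R →ₐ[𝒪] 𝓡'.R, Deformation.IsStrictEquiv (𝓡'.π : 𝓡'.R →+* k)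
      ((Matrix.GeneralLinearGroup.map (φ : 𝓡.R →+* 𝓡'.R)).comp 𝓡.ρ) 𝓡'.ρ :=
  𝓡.universal 𝓡'.R 𝓡'.π 𝓡'.π_surjective 𝓡'.ρ 𝓡'.isDeformation.toPolarized

/-- **Existence of the universal polarized `S`-unramified deformation ring** (discharge of
`polarizedDeformationRing_nonempty`).  Proof as in Mazur (§26 Prop. 1 → §23 → §20 Prop. 2): after
the rank-`n` rigidification `PolarizedDatum.RigidData` (a square subsystem of prescribed entries,
which exists because `r̄` has scalar centralizer, `exists_commLinAt_injective`), the rigid lifts of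
type `𝒟` form a deformation condition for `Π = Γ_F` (`RigidData.liftingCondition`), whose
`k[ε]`-points are finite by the `p`-finiteness of `G_{F,S}` (`finite_carrier_dualCNL`); Mazur's
§20 Prop. 2 (`LiftingCondition.exists_universal_of_finite`) represents it, and every strict
equivalence class of type-`𝒟` lifts over a complete local ring contains exactly one rigid lift
(`exists_rigid`, `rigid_unique`), so the universal rigid lift is the universal polarized
deformation (`nonempty_deformationRing`).  The hypotheses "`𝒪` local complete, `k` of
characteristic `p`" of the fact are not used by the proof.
[cite: Mazur1997Deformation, §20 Prop. 2 and §26 Prop. 1] [cite: ClozelHarrisTaylor2008, §2.2] -/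
theorem polarizedDeformationRing_nonempty_holds : polarizedDeformationRing_nonempty := by
  intro F₀ F _ _ _ _ _ p n _ 𝒪 _ _ _ _ _ k _ _ _ _ 𝒟 hsc
  obtain ⟨R⟩ := 𝒟.nonempty_rigidData hsc
  exact R.nonempty_deformationRing 𝒟.residueMap_surjective (R.finite_carrier_dualCNL 𝒟.residueMap_surjective)

end Literature.NumberTheory.GaloisRepresentations
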